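import Literature.NumberTheory.Sieve.PolymathThetaCRT
import Literature.NumberTheory.Sieve.PolymathSieveAsymptoticsProofs
import Literature.NumberTheory.Sieve.MaynardSieveLemma52
import HarnessLib

/-!
# Polymath 8b, Theorem 3.5(i) PROVED (`theta_divisorSumWeights_asymptotic_holds`) and Theorem 3.12(i) PROVED (`weakDHL_of_polymathFunctional_gt_holds`)

Trunk: AntSieve / parity.S13.  Companion ("Proofs") file of `PolymathSieveAsymptotics.lean`,
discharging its named fact `Literature.NumberTheory.Sieve.theta_divisorSumWeights_asymptotic` —
**Theorem 3.5(i)** of D. H. J. Polymath, *Variants of the Selberg sieve, and bounded intervals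
containing many primes*, Res. Math. Sci. 1:12 (2014) = arXiv:1407.4897 (asymptotic for prime sums,
Elliott–Halberstam case), proved in §4.2, pp. 13–14 — and with it **Theorem 3.12(i)** (the named fact
`Literature.NumberTheory.Sieve.weakDHL_of_polymathFunctional_gt` of `PolymathBoundedGaps.lean`), whose
three printed ingredients are now all theorems of the tree (Theorem 3.5(i) here, Theorem 3.6(i)
`divisorSumWeights_asymptotic_holds` in `PolymathLcmSumsProofs.lean`, the analytic step of §5.3
`exists_tensorCutoffs_of_polymathFunctional_gt_holds` in `PolymathSieveAsymptoticsProofs.lean`;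
assembled by `weakDHL_of_polymathFunctional_gt_of_parts`).  After this file the decomposition of
`Literature.NumberTheory.Sieve.frequently_nth_prime_succ_le_add_polymath` (`H₁ ≤ 246`, Theorem 1.4(i))
rests on the single numerical named fact `exists_polymathFunctional_fifty_gt` (Theorem 3.13(i),
`M_{50,1/25} > 4.0043`) and the Bombieri–Vinogradov theorem (proved in the tree).

The proof of Theorem 3.5(i) is the printed one (§4.2):

* `thetaX1 h₀ x = ⌈x⌉ + h₀ − 1`, `thetaX2 h₀ x = ⌊2x⌋ + h₀` and `eventually_abs_thetaInterval_sub_le`: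
  "From the prime number theorem we have `∑_{x+h_k ≤ n ≤ 2x+h_k} θ(n) = (1+o(1)) x`", from
  `ϑ(y) = y + O(y/log² y)` (`Literature.NumberTheory.LFunctions.ChebyshevThetaDeLaValleePoussin_holds`).
* `theta_divisorSumWeights_asymptotic_holds`: expansion (theta-oo2) of the divisor sums and vanishing
  of the inadmissible terms (as in §4.1, `not_forall_lcm_dvd_of_not_lcmCoprime`); the Chinese remainder
  theorem to one primitive class and (ts) (`PolymathThetaCRT.lean`); the main term
  `(1/φ(q)) ∑ θ = (Θ/φ(W)) ∏ 1/φ([d_i,d'_i])` summed "by Lemma 4.1" in its `φ`-variant in `k − 1` variables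
  (`LcmEuler.tendsto_pow_mul_lcmSumW` with `isLcmWeight_totient_inv`, `PolymathLcmSumsProofs.lean`) and
  the prime number theorem; the error (sosmall) bounded through `abs_thetaAP_sub_le`, the multiplicity
  bound `sum_modulusOf_le` ("`O(τ(q)^{O(1)})` choices"), the range `q ≤ W x^{∑(S(F_i)+S(G_i))} ≤ X₂^{ϑ−ε₁}`
  (`W ≤ log² x`), and the divisor-weighted level estimate
  `PrimesHaveLevelPi.isBigO_sum_pow_omega_mul_errMax` (`PolymathThetaLevel.lean`) applied at `X₂`, with
  `EH[ϑ]` entering as `PrimesHaveLevel ϑ ↔ PrimesHaveLevelPi ϑ` (`primesHaveLevel_iff_primesHaveLevelPi_holds`).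

The assembly is one long tactic block (the printed §4.2 argument with explicit constants); it needs a
raised heartbeat budget (`set_option maxHeartbeats 1600000`, about 60 s of elaboration).

## References

* D. H. J. Polymath, *Variants of the Selberg sieve, and bounded intervals containing many primes*,
  Res. Math. Sci. 1 (2014), Art. 12; arXiv:1407.4897, Theorem 3.5(i), §4.2 (pp. 13–14), Theorem 3.12(i).
  [Polymath8b2014]
-/

noncomputable section

open Finset Filter Asymptotics MeasureTheory
open scoped BigOperators ArithmeticFunction.omega ArithmeticFunction.Moebius

namespace Literature.NumberTheory.Sieve

/-! ### The interval endpoints and the prime number theorem for `∑_{x+h₀ ≤ m ≤ 2x+h₀} θ(m)` -/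

/-- `X₁(x) := ⌈x⌉ + h₀ − 1` (as a natural number). [folklore] -/
def thetaX1 (h₀ : ℤ) (x : ℝ) : ℕ := ((⌈x⌉₊ : ℤ) + h₀ - 1).toNat

/-- `X₂(x) := ⌊2x⌋ + h₀` (as a natural number). [folklore] -/
def thetaX2 (h₀ : ℤ) (x : ℝ) : ℕ := ((⌊2 * x⌋₊ : ℤ) + h₀).toNat

/-- Sizes of the endpoints for `x ≥ |h₀| + 2`. [folklore] -/
theorem thetaX_bounds (h₀ : ℤ) {x : ℝ} (hx : (h₀.natAbs : ℝ) + 2 ≤ x) :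
    1 ≤ thetaX1 h₀ x ∧ thetaX1 h₀ x ≤ thetaX2 h₀ x ∧
      x - 2 ≤ (thetaX1 h₀ x : ℝ) - h₀ ∧ (thetaX1 h₀ x : ℝ) - h₀ ≤ x ∧
      2 * x - 1 ≤ (thetaX2 h₀ x : ℝ) - h₀ ∧ (thetaX2 h₀ x : ℝ) - h₀ ≤ 2 * x ∧
      ((thetaX1 h₀ x : ℕ) : ℤ) = (⌈x⌉₊ : ℤ) + h₀ - 1 ∧ ((thetaX2 h₀ x : ℕ) : ℤ) = (⌊2 * x⌋₊ : ℤ) + h₀ := by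
  have hx0 : 0 ≤ x := le_trans (by positivity) hx
  have habs : ((h₀.natAbs : ℕ) : ℝ) = |(h₀ : ℝ)| := by rw [Nat.cast_natAbs, Int.cast_abs]
  have hh1 : -(h₀ : ℝ) ≤ h₀.natAbs := by rw [habs]; exact neg_le_abs _
  have hh2 : (h₀ : ℝ) ≤ h₀.natAbs := by rw [habs]; exact le_abs_self _
  have hceil : x ≤ (⌈x⌉₊ : ℝ) := Nat.le_ceil x
  have hceil' : (⌈x⌉₊ : ℝ) < x + 1 := Nat.ceil_lt_add_one hx0
  have hfl : ((⌊2 * x⌋₊ : ℕ) : ℝ) ≤ 2 * x := Nat.floor_le (by linarith)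
  have hfl' : 2 * x < ((⌊2 * x⌋₊ : ℕ) : ℝ) + 1 := Nat.lt_floor_add_one _
  have hz1 : (1 : ℤ) ≤ (⌈x⌉₊ : ℤ) + h₀ - 1 := by
    have : (1 : ℝ) ≤ (⌈x⌉₊ : ℝ) + h₀ - 1 := by linarith
    exact_mod_cast this
  have hz2 : (⌈x⌉₊ : ℤ) + h₀ - 1 ≤ (⌊2 * x⌋₊ : ℤ) + h₀ := by
    have : (⌈x⌉₊ : ℝ) - 1 ≤ ((⌊2 * x⌋₊ : ℕ) : ℝ) := by linarith
    have : (⌈x⌉₊ : ℤ) - 1 ≤ (⌊2 * x⌋₊ : ℤ) := by exact_mod_cast this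
    linarith
  have e1 : ((thetaX1 h₀ x : ℕ) : ℤ) = (⌈x⌉₊ : ℤ) + h₀ - 1 := Int.toNat_of_nonneg (by linarith)
  have e2 : ((thetaX2 h₀ x : ℕ) : ℤ) = (⌊2 * x⌋₊ : ℤ) + h₀ := Int.toNat_of_nonneg (by linarith)
  have e1r : ((thetaX1 h₀ x : ℕ) : ℝ) = (⌈x⌉₊ : ℝ) + h₀ - 1 := by exact_mod_cast e1
  have e2r : ((thetaX2 h₀ x : ℕ) : ℝ) = ((⌊2 * x⌋₊ : ℕ) : ℝ) + h₀ := by exact_mod_cast e2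
  refine ⟨?_, ?_, ?_, ?_, ?_, ?_, e1, e2⟩
  · have : (1 : ℤ) ≤ ((thetaX1 h₀ x : ℕ) : ℤ) := by rw [e1]; exact hz1
    exact_mod_cast this
  · have : ((thetaX1 h₀ x : ℕ) : ℤ) ≤ ((thetaX2 h₀ x : ℕ) : ℤ) := by rw [e1, e2]; exact hz2
    exact_mod_cast this
  · rw [e1r]; linarith
  · rw [e1r]; linarith
  · rw [e2r]; linarith
  · rw [e2r]; linarith

/-- `X₂(x) → ∞`. [folklore] -/
theorem tendsto_thetaX2 (h₀ : ℤ) : Tendsto (fun x : ℝ => (thetaX2 h₀ x : ℝ)) atTop atTop := by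
  refine tendsto_atTop_mono' atTop ?_ (tendsto_id.atTop_add (tendsto_const_nhds (x := (h₀ : ℝ) - 1)))
  filter_upwards [eventually_ge_atTop ((h₀.natAbs : ℝ) + 2)] with x hx
  obtain ⟨-, -, -, -, h5, -⟩ := thetaX_bounds h₀ hx
  simp only [id]
  linarith

/-- `∑_{X₁ < m ≤ X₂} θ(m) = ϑ(X₂) − ϑ(X₁)`. [folklore] -/
theorem thetaInterval_eq_theta_sub {X₁ X₂ : ℕ} (h : X₁ ≤ X₂) :
    thetaInterval X₁ X₂ = Chebyshev.theta X₂ - Chebyshev.theta X₁ := by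
  rw [MaynardSieve.theta_sub_theta_eq_sum h, thetaInterval, Finset.sum_filter]
  refine Finset.sum_congr rfl fun m _ => ?_
  unfold GPY.theta
  rfl

/-- **The prime number theorem for the main term of (ts)**: `∑_{x+h₀ ≤ m ≤ 2x+h₀} θ(m) = (1 + o(1)) x`
(Polymath 8b p. 13: "From the prime number theorem we have `∑_{x+h_k ≤ n ≤ 2x+h_k} θ(n) = (1+o(1)) x`"),
from `ϑ(y) = y + O(y/log² y)` (`Literature.NumberTheory.LFunctions.ChebyshevThetaDeLaValleePoussin_holds`).
[cite: Polymath8b2014, §4.2, p. 13] -/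
theorem eventually_abs_thetaInterval_sub_le (h₀ : ℤ) {ε : ℝ} (hε : 0 < ε) :
    ∀ᶠ x : ℝ in atTop, |thetaInterval (thetaX1 h₀ x) (thetaX2 h₀ x) - x| ≤ ε * x := by
  obtain ⟨C, hC'⟩ := LFunctions.ChebyshevThetaDeLaValleePoussin_holds.logPow 2
  have hC : ∀ y : ℝ, 2 ≤ y → |Chebyshev.theta y - y| ≤ C * y / Real.log y ^ 2 := fun y hy => by
    have := hC' y hy
    rwa [Real.rpow_two] at this
  have hC0 : 0 ≤ C := by
    have h2 := (abs_nonneg _).trans (hC 2 le_rfl)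
    have hl : 0 < Real.log 2 := Real.log_pos (by norm_num)
    have hpos : (0 : ℝ) < 2 / Real.log 2 ^ 2 := by positivity
    rw [mul_div_assoc] at h2
    by_contra hneg
    push Not at hneg
    have := mul_neg_of_neg_of_pos hneg hpos
    linarith
  -- `log y ≥ (log x)` for `y ≥ x - 2 - |h₀|`… we simply use `log y ≥ log 2` and a large `x`
  have hlim : Tendsto (fun x : ℝ => (6 * C) / Real.log (x / 2) ^ 2) atTop (nhds 0) := by
    have h1 : Tendsto (fun x : ℝ => Real.log (x / 2) ^ 2) atTop atTop := by
      have := (Real.tendsto_log_atTop.comp (tendsto_id.atTop_div_const (by norm_num : (0 : ℝ) < 2)))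
      exact (tendsto_pow_atTop two_ne_zero).comp this
    exact tendsto_const_nhds.div_atTop h1
  filter_upwards [eventually_ge_atTop ((h₀.natAbs : ℝ) + 2), eventually_ge_atTop (8 + 4 * (h₀.natAbs : ℝ)),
    hlim.eventually_le_const (half_pos hε), eventually_ge_atTop (6 / ε)] with x hx hx8 hlimx hxε
  obtain ⟨h1, h12, h3, h4, h5, h6, -, -⟩ := thetaX_bounds h₀ hx
  have habs : ((h₀.natAbs : ℕ) : ℝ) = |(h₀ : ℝ)| := by rw [Nat.cast_natAbs, Int.cast_abs]
  have hh1 : -(h₀ : ℝ) ≤ h₀.natAbs := by rw [habs]; exact neg_le_abs _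
  have hh2 : (h₀ : ℝ) ≤ h₀.natAbs := by rw [habs]; exact le_abs_self _
  set Y₁ : ℝ := (thetaX1 h₀ x : ℝ) with hY₁
  set Y₂ : ℝ := (thetaX2 h₀ x : ℝ) with hY₂
  have hY₁lo : x / 2 ≤ Y₁ := by linarith
  have hY₂lo : x / 2 ≤ Y₂ := by linarith
  have hY₁hi : Y₁ ≤ 3 * x := by linarith
  have hY₂hi : Y₂ ≤ 3 * x := by linarith
  have hx2 : 2 ≤ x / 2 := by linarith
  have hlog2 : 0 < Real.log (x / 2) := Real.log_pos (by linarith)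
  have hbound : ∀ Y : ℝ, x / 2 ≤ Y → Y ≤ 3 * x → |Chebyshev.theta Y - Y| ≤ 3 * C * x / Real.log (x / 2) ^ 2 := by
    intro Y hYlo hYhi
    have hY2 : 2 ≤ Y := hx2.trans hYlo
    refine (hC Y hY2).trans ?_
    have hlogY : Real.log (x / 2) ≤ Real.log Y := Real.log_le_log (by linarith) hYlo
    have hlogY0 : 0 < Real.log Y := lt_of_lt_of_le hlog2 hlogY
    have hpow := pow_le_pow_left₀ hlog2.le hlogY 2
    calc C * Y / Real.log Y ^ 2 ≤ C * (3 * x) / Real.log Y ^ 2 := by gcongr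
      _ ≤ C * (3 * x) / Real.log (x / 2) ^ 2 :=
          div_le_div_of_nonneg_left (mul_nonneg hC0 (by linarith)) (pow_pos hlog2 2) hpow
      _ = 3 * C * x / Real.log (x / 2) ^ 2 := by ring
  rw [thetaInterval_eq_theta_sub h12]
  have e : Chebyshev.theta Y₂ - Chebyshev.theta Y₁ - x =
      (Chebyshev.theta Y₂ - Y₂) - (Chebyshev.theta Y₁ - Y₁) + (Y₂ - Y₁ - x) := by ring
  rw [e]
  have hmid : |Y₂ - Y₁ - x| ≤ 3 := by
    rw [abs_le]; constructor <;> linarith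
  calc |Chebyshev.theta Y₂ - Y₂ - (Chebyshev.theta Y₁ - Y₁) + (Y₂ - Y₁ - x)|
      ≤ |Chebyshev.theta Y₂ - Y₂| + |Chebyshev.theta Y₁ - Y₁| + |Y₂ - Y₁ - x| :=
        (abs_add_le _ _).trans (add_le_add (abs_sub _ _) le_rfl)
    _ ≤ 3 * C * x / Real.log (x / 2) ^ 2 + 3 * C * x / Real.log (x / 2) ^ 2 + 3 :=
        add_le_add (add_le_add (hbound Y₂ hY₂lo hY₂hi) (hbound Y₁ hY₁lo hY₁hi)) hmid
    _ = (6 * C) / Real.log (x / 2) ^ 2 * x + 3 := by ring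
    _ ≤ ε / 2 * x + ε / 2 * x := by
        refine add_le_add (mul_le_mul_of_nonneg_right hlimx (by linarith)) ?_
        rw [div_le_iff₀ hε] at hxε
        linarith
    _ = ε * x := by ring

/-! ### Theorem 3.5(i) -/

open LcmEuler in
/-- The real form of the `φ`-weighted sum (multisum): `lcmSumW` with `w = 1/φ` is the real double sum
`∑∑ [coprimality] (∏ μμFG) ∏ 1/φ([d_i,d'_i])`. [folklore] -/
theorem lcmSumW_totient_eq_ofReal {ι : Type*} [Fintype ι] [DecidableEq ι] (W : ℕ) (F G : ι → ℝ → ℝ)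
    (x : ℝ) (D : ℕ) :
    lcmSumW (fun n => ((Nat.totient n : ℕ) : ℂ)⁻¹) W F G x D =
      ((∑ d ∈ lcmBox ι D, ∑ d' ∈ lcmBox ι D, if LcmCoprime W d d' then
        (∏ i, ((μ (d i) : ℝ) * F i (Real.log (d i) / Real.log x)) *
          ((μ (d' i) : ℝ) * G i (Real.log (d' i) / Real.log x))) *
        ∏ i, ((Nat.totient (Nat.lcm (d i) (d' i)) : ℕ) : ℝ)⁻¹ else 0 : ℝ) : ℂ) := by
  unfold lcmSumW lcmTermW
  rw [Complex.ofReal_sum]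
  refine Finset.sum_congr rfl fun d _ => ?_
  rw [Complex.ofReal_sum]
  refine Finset.sum_congr rfl fun d' _ => ?_
  split_ifs
  · rw [Complex.ofReal_mul, Complex.ofReal_prod, Complex.ofReal_prod, ← Finset.prod_mul_distrib]
    refine Finset.prod_congr rfl fun i _ => ?_
    push_cast
    ring
  · simp

-- one long tactic block (the printed §4.2 argument with explicit constants): the default budget does not suffice
set_option maxHeartbeats 1600000 in
open LcmEuler in
/-- **Polymath 8b, Theorem 3.5(i), PROVED** (asymptotic for prime sums, Elliott–Halberstam case; §4.2,
pp. 13–14 of arXiv:1407.4897): the named fact `theta_divisorSumWeights_asymptotic` of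
`PolymathSieveAsymptotics.lean`.  The proof is the printed one: expansion of the divisor sums and
vanishing of the inadmissible terms (as in §4.1), the Chinese remainder theorem to a single primitive
class `n + h₀ ≡ a (q)`, `q = W∏[d_i,d'_i]` (`PolymathThetaCRT.lean`), (ts): main term
`(1/φ(q)) ∑_{x+h₀ ≤ m ≤ 2x+h₀} θ(m)` evaluated by the prime number theorem and the `φ`-variant of
Lemma 4.1 in `k − 1` variables (`LcmEuler.tendsto_pow_mul_lcmSumW` with `isLcmWeight_totient_inv`), and
the error (sosmall) bounded by the level of distribution through `abs_thetaAP_sub_le`,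
`sum_modulusOf_le` and `PrimesHaveLevelPi.isBigO_sum_pow_omega_mul_errMax` (`PolymathThetaLevel.lean`),
`EH[ϑ]` entering as `PrimesHaveLevel ϑ ↔ PrimesHaveLevelPi ϑ` (`primesHaveLevel_iff_primesHaveLevelPi_holds`).
[cite: Polymath8b2014, Theorem 3.5(i)] -/
theorem theta_divisorSumWeights_asymptotic_holds : theta_divisorSumWeights_asymptotic := by
  intro H hH hk2 b hb h₀ hh₀ θ hθ0 hθ1 hlevel F G sF sG hF hG hsum
  classical
  -- the index set `H' = H ∖ {h₀}` and `k = #H' = #H - 1`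
  set H' : Finset ℤ := H.erase h₀ with hH'def
  set k : ℕ := #H' with hkdef
  have hkH : #H - 1 = k := by rw [hkdef, hH'def, Finset.card_erase_of_mem hh₀]
  have hk1 : 1 ≤ k := by omega
  simp only [hkH]
  set σ : ℝ := ∑ h ∈ H', (sF h + sG h) with hσdef
  have hσθ : σ < θ := hsum
  have hσ0 : 0 ≤ σ := Finset.sum_nonneg fun i hi => add_nonneg (hF i hi).nonneg (hG i hi).nonneg
  have hsFle : ∀ h ∈ H', sF h ≤ σ - sG h := fun h hh => by
    have h1 : sF h + sG h ≤ σ := Finset.single_le_sum (f := fun h => sF h + sG h)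
      (fun i hi => add_nonneg (hF i hi).nonneg (hG i hi).nonneg) hh
    linarith
  have hsF1 : ∀ h ∈ H', sF h < 1 := fun h hh => by
    linarith [hsFle h hh, (hG h hh).nonneg]
  have hsG1 : ∀ h ∈ H', sG h < 1 := fun h hh => by
    linarith [hsFle h hh, (hF h hh).nonneg]
  clear_value σ
  have hmemH : ∀ i : ↥H', (i : ℤ) ∈ H ∧ (i : ℤ) ≠ h₀ := fun i => by
    have := Finset.mem_erase.1 (show (i : ℤ) ∈ H.erase h₀ from i.2); exact ⟨this.2, this.1⟩
  -- Lemma 4.1 with the weight `1/φ`, `T = 1`, indexed by `↥H'`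
  have h41 := LcmEuler.tendsto_pow_mul_lcmSumW (ι := ↥H') (F := fun i => F i) (G := fun i => G i)
    (sF := fun i => sF i) (sG := fun i => sG i)
    (fun i => hF i i.2) (fun i => hG i i.2) isLcmWeight_totient_inv (T := 1)
    (fun i => (hsF1 i i.2).le) (fun i => (hsG1 i i.2).le)
  rw [Fintype.card_coe] at h41
  -- the constant `c`
  set c : ℝ := ∏ h ∈ H', ∫ t in (0 : ℝ)..1, deriv (F h) t * deriv (G h) t with hcdef
  have hc : (∏ i : ↥H', ((∫ t in Set.Ioi (0 : ℝ), deriv (F i) t * deriv (G i) t : ℝ) : ℂ)) = (c : ℂ) := by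
    rw [hcdef, ← Finset.prod_coe_sort H', Complex.ofReal_prod]
    exact Finset.prod_congr rfl fun i _ => by rw [(hF i i.2).setIntegral_Ioi_deriv_mul (hsF1 i i.2).le]
  rw [hc] at h41
  clear_value c
  -- the real `φ`-weighted sum and its limit
  set Sφ : ℝ → ℝ := fun x => ∑ d ∈ lcmBox (↥H') ⌊x⌋₊, ∑ d' ∈ lcmBox (↥H') ⌊x⌋₊,
    if LcmCoprime (polymathW x) d d' then
      (∏ i : ↥H', ((μ (d i) : ℝ) * F i (Real.log (d i) / Real.log x)) *
        ((μ (d' i) : ℝ) * G i (Real.log (d' i) / Real.log x))) *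
      ∏ i : ↥H', ((Nat.totient (Nat.lcm (d i) (d' i)) : ℕ) : ℝ)⁻¹ else 0 with hSφdef
  have h41r : Tendsto (fun x : ℝ => polymathB x ^ k * Sφ x) atTop (nhds c) := by
    have h2 := (Complex.continuous_re.tendsto _).comp h41
    rw [Complex.ofReal_re] at h2
    refine h2.congr fun x => ?_
    rw [Function.comp_apply, Real.rpow_one, lcmSumW_totient_eq_ofReal, ← Complex.ofReal_pow,
      ← Complex.ofReal_mul, Complex.ofReal_re]
  clear_value Sφ
  -- the level of distribution in the `π`-form, divisor-weighted
  have hlevelPi : PrimesHaveLevelPi θ := (primesHaveLevel_iff_primesHaveLevelPi_holds θ).1 hlevel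
  set ε₁ : ℝ := (θ - σ) / 3 with hε₁def
  have hε₁ : 0 < ε₁ := by rw [hε₁def]; linarith
  set K : ℝ := ((3 * k + 1 : ℕ) : ℝ) with hKdef
  have hbig := (hlevelPi.isBigO_sum_pow_omega_mul_errMax hε₁ (K := K) (by positivity)
    (A := (k : ℝ) + 4) (by positivity)).comp_tendsto (tendsto_thetaX2 h₀)
  obtain ⟨Cb, hCbpos, hCb⟩ := hbig.exists_pos
  rw [IsBigOWith] at hCb
  have hK0 : 0 ≤ K := by rw [hKdef]; positivity
  clear_value ε₁ K
  -- a uniform bound `M` for the cutoffs on `[0, 1]`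
  obtain ⟨M, hM0, hMF, hMG⟩ : ∃ M : ℝ, 0 ≤ M ∧ (∀ h ∈ H', ∀ t ∈ Set.Icc (0 : ℝ) 1, |F h t| ≤ M) ∧
      (∀ h ∈ H', ∀ t ∈ Set.Icc (0 : ℝ) 1, |G h t| ≤ M) := by
    have hbd : ∀ f : ℝ → ℝ, Continuous f → ∃ C, ∀ t ∈ Set.Icc (0 : ℝ) 1, |f t| ≤ C := fun f hf => by
      obtain ⟨C, hC⟩ := isCompact_Icc.exists_bound_of_continuousOn hf.continuousOn
      exact ⟨C, fun t ht => by simpa [Real.norm_eq_abs] using hC t ht⟩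
    choose CF hCF using fun h : ↥H' => hbd (F h) (hF h h.2).contDiff.continuous
    choose CG hCG using fun h : ↥H' => hbd (G h) (hG h h.2).contDiff.continuous
    refine ⟨∑ i : ↥H', (|CF i| + |CG i|), Finset.sum_nonneg fun i _ => by positivity, ?_, ?_⟩
    · intro h hh t ht
      have h1 := hCF ⟨h, hh⟩ t ht
      have h2 : |CF ⟨h, hh⟩| + |CG ⟨h, hh⟩| ≤ ∑ i : ↥H', (|CF i| + |CG i|) :=
        Finset.single_le_sum (f := fun i : ↥H' => |CF i| + |CG i|) (fun i _ => by positivity)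
          (Finset.mem_univ _)
      linarith [le_abs_self (CF ⟨h, hh⟩), abs_nonneg (CG ⟨h, hh⟩)]
    · intro h hh t ht
      have h1 := hCG ⟨h, hh⟩ t ht
      have h2 : |CF ⟨h, hh⟩| + |CG ⟨h, hh⟩| ≤ ∑ i : ↥H', (|CF i| + |CG i|) :=
        Finset.single_le_sum (f := fun i : ↥H' => |CF i| + |CG i|) (fun i _ => by positivity)
          (Finset.mem_univ _)
      linarith [le_abs_self (CG ⟨h, hh⟩), abs_nonneg (CF ⟨h, hh⟩)]
  -- size of the shifts
  set P₀ : ℕ := ∑ h ∈ H, h.natAbs with hP₀def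
  have hP₀ : ∀ h ∈ H, h.natAbs ≤ P₀ := fun h hh =>
    Finset.single_le_sum (f := fun h : ℤ => h.natAbs) (fun _ _ => Nat.zero_le _) hh
  have hP₀h₀ : h₀.natAbs ≤ P₀ := hP₀ h₀ hh₀
  -- the `ε`-argument
  refine Asymptotics.isLittleO_iff.2 fun ε hε => ?_
  set εP : ℝ := min 1 (ε / (3 * (|c| + 1))) with hεPdef
  have hεP : 0 < εP := by positivity
  have hεP1 : εP ≤ 1 := min_le_left _ _
  have hεPc : |c| * εP ≤ ε / 3 := by
    have h1 : εP ≤ ε / (3 * (|c| + 1)) := min_le_right _ _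
    have h2 : |c| * (ε / (3 * (|c| + 1))) ≤ ε / 3 := by
      rw [mul_div_assoc', div_le_div_iff₀ (by positivity) (by positivity)]
      nlinarith [abs_nonneg c]
    exact le_trans (mul_le_mul_of_nonneg_left h1 (abs_nonneg c)) h2
  have hε9 : 0 < ε / 9 := by positivity
  set Cerr : ℝ := 72 * (M ^ k * M ^ k) * Cb with hCerrdef
  filter_upwards [eventually_gt_atTop (3 : ℝ),
    Metric.tendsto_nhds.1 h41r (ε / 9) hε9,
    eventually_abs_thetaInterval_sub_le h₀ hεP,
    hCb,
    eventually_ge_atTop ((P₀ : ℝ) + 2),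
    (tendsto_nat_floor_atTop.comp tendsto_polymathw_atTop).eventually_ge_atTop (2 * P₀),
    eventually_polymathW_le_log_sq,
    Real.tendsto_log_atTop.eventually_ge_atTop (1 : ℝ),
    (isLittleO_log_rpow_rpow_atTop 2 hε₁).def zero_lt_one,
    Real.tendsto_log_atTop.eventually_ge_atTop (Cerr / ε)]
    with x hx3 hx41 hxPNT hxCb hxP hxw hxW hxlog hxlogε hxCerr
  clear h41 h41r hbig hCb hlevel hlevelPi hH
  -- notation and positivity at this `x`
  have hx1 : 1 < x := by linarith
  have hx0 : 0 ≤ x := by linarith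
  have hxpos : 0 < x := by linarith
  -- make the level-of-distribution bound opaque
  obtain ⟨Lsum, hLsum_def, hLsum⟩ : ∃ L : ℝ,
      L = ∑ q ∈ Finset.Icc 1 ⌊((thetaX2 h₀ x : ℕ) : ℝ) ^ (θ - ε₁)⌋₊,
        K ^ ω q * primeCountingAPErrMax ((thetaX2 h₀ x : ℕ) : ℝ) q ∧
      ‖L‖ ≤ Cb * ‖((thetaX2 h₀ x : ℕ) : ℝ) / Real.log ((thetaX2 h₀ x : ℕ) : ℝ) ^ ((k : ℝ) + 4)‖ :=
    ⟨_, rfl, hxCb⟩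
  clear hxCb
  have hlog : 0 < Real.log x := Real.log_pos hx1
  have hWpos : 0 < polymathW x := polymathW_pos x
  have hWr : (0 : ℝ) < polymathW x := Nat.cast_pos.2 hWpos
  have hφpos : 0 < Nat.totient (polymathW x) := totient_polymathW_pos x
  have hφr : (0 : ℝ) < Nat.totient (polymathW x) := Nat.cast_pos.2 hφpos
  have hB : 0 < polymathB x := polymathB_pos hx1
  have hBk : 0 < polymathB x ^ k := pow_pos hB k
  set D : ℕ := ⌊x⌋₊ with hDdef
  set R : Finset ℕ := polymathRange x (b x) with hRdef
  set Mx : ℝ := x / (polymathB x ^ k * Nat.totient (polymathW x)) with hMx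
  have hMx0 : 0 < Mx := by positivity
  have hxh₀ : (h₀.natAbs : ℝ) + 2 ≤ x := by
    have : (h₀.natAbs : ℝ) ≤ P₀ := by exact_mod_cast hP₀h₀
    linarith
  have habsR : ((h₀.natAbs : ℕ) : ℝ) = |(h₀ : ℝ)| := by rw [Nat.cast_natAbs, Int.cast_abs]
  have hh₀1 : -(h₀ : ℝ) ≤ h₀.natAbs := by rw [habsR]; exact neg_le_abs _
  have hh₀2 : (h₀ : ℝ) ≤ h₀.natAbs := by rw [habsR]; exact le_abs_self _
  obtain ⟨hX₁1, hX₁₂, hX₁lo, hX₁hi, hX₂lo, hX₂hi, hX₁z, hX₂z⟩ := thetaX_bounds h₀ hxh₀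
  set X₁ : ℕ := thetaX1 h₀ x with hX₁def
  set X₂ : ℕ := thetaX2 h₀ x with hX₂def
  clear_value X₁ X₂
  set Θ : ℝ := thetaInterval X₁ X₂ with hΘdef
  have hΘ0 : 0 ≤ Θ := Finset.sum_nonneg fun m _ => GPY.theta_nonneg m
  clear_value Θ
  have hΘx : |Θ - x| ≤ εP * x := hxPNT
  clear hxPNT
  have hΘ2x : Θ ≤ 2 * x := by
    have h1 := (abs_le.1 hΘx).2
    have h2 : εP * x ≤ 1 * x := mul_le_mul_of_nonneg_right hεP1 hx0
    linarith
  -- vanishing of the cutoffs beyond `D = ⌊x⌋`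
  have hvan : ∀ (f : ℝ → ℝ) (s : ℝ), IsSieveCutoff f s → s < 1 →
      ∀ e : ℕ, D < e → f (Real.log e / Real.log x) = 0 := by
    intro f s hf hs e he
    apply hf.eq_zero
    have he' : x < e := by
      have : (D : ℝ) + 1 ≤ e := by exact_mod_cast he
      linarith [Nat.lt_floor_add_one x]
    rw [lt_div_iff₀ hlog]
    calc s * Real.log x < 1 * Real.log x := mul_lt_mul_of_pos_right hs hlog
      _ = Real.log x := one_mul _
      _ < Real.log e := Real.log_lt_log hxpos he'
  -- members of the range are large
  have hRmem : ∀ n ∈ R, x ≤ n ∧ (n : ℤ) ≡ b x [ZMOD (polymathW x)] := fun n hn =>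
    ⟨(le_of_mem_polymathRange hx0 hn).1, (Finset.mem_filter.1 hn).2⟩
  have hnpos : ∀ n ∈ R, ∀ i : ↥H', 0 < (n : ℤ) + (i : ℤ) := by
    intro n hn i
    have h2 : (P₀ : ℝ) + 2 ≤ n := hxP.trans (hRmem n hn).1
    have h4 : ((P₀ : ℕ) : ℤ) + 2 ≤ n := by exact_mod_cast h2
    have h5 : (i : ℤ).natAbs ≤ P₀ := hP₀ i (hmemH i).1
    omega
  -- the coefficients and the θ-weighted counts
  set a : ↥H' → ℕ → ℝ := fun i e => (μ e : ℝ) * F i (Real.log e / Real.log x) with hadef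
  set a' : ↥H' → ℕ → ℝ := fun i e => (μ e : ℝ) * G i (Real.log e / Real.log x) with ha'def
  set cc : (↥H' → ℕ) → (↥H' → ℕ) → ℝ := fun d d' => ∏ i, (a i (d i) * a' i (d' i)) with hccdef
  set Nθ : (↥H' → ℕ) → (↥H' → ℕ) → ℝ := fun d d' =>
    ∑ n ∈ R.filter (fun n : ℕ => ∀ i : ↥H', ((Nat.lcm (d i) (d' i) : ℕ) : ℤ) ∣ (n : ℤ) + (i : ℤ)),
      GPY.theta (((n : ℤ) + h₀).toNat) with hNθdef
  -- Step 1: expansion of the product of divisor sums, for `n ∈ R`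
  have hstep1 : ∀ n ∈ R,
      GPY.theta (((n : ℤ) + h₀).toNat) * ∏ h ∈ H', (divisorSumWeight (F h) x ((n : ℤ) + h).toNat *
        divisorSumWeight (G h) x ((n : ℤ) + h).toNat) =
      ∑ d ∈ lcmBox (↥H') D, ∑ d' ∈ lcmBox (↥H') D,
        if ∀ i : ↥H', ((Nat.lcm (d i) (d' i) : ℕ) : ℤ) ∣ (n : ℤ) + (i : ℤ) then
          GPY.theta (((n : ℤ) + h₀).toNat) * cc d d' else 0 := by
    intro n hn
    set m : ↥H' → ℕ := fun i => ((n : ℤ) + (i : ℤ)).toNat with hmdef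
    have hmcast : ∀ i : ↥H', ((m i : ℕ) : ℤ) = (n : ℤ) + (i : ℤ) := fun i =>
      Int.toNat_of_nonneg (hnpos n hn i).le
    have hm0 : ∀ i : ↥H', m i ≠ 0 := fun i h0 => by
      have := hmcast i; rw [h0] at this; have := hnpos n hn i; omega
    rw [← Finset.prod_coe_sort H']
    have h1 : ∀ i : ↥H', divisorSumWeight (F i) x ((n : ℤ) + (i : ℤ)).toNat *
        divisorSumWeight (G i) x ((n : ℤ) + (i : ℤ)).toNat =
        (∑ e ∈ Finset.Icc 1 D, if e ∣ m i then a i e else 0) *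
          ∑ e ∈ Finset.Icc 1 D, if e ∣ m i then a' i e else 0 := by
      intro i
      rw [divisorSumWeight_eq_sum_Icc (F i) x (hm0 i) (hvan _ _ (hF i i.2) (hsF1 i i.2)),
        divisorSumWeight_eq_sum_Icc (G i) x (hm0 i) (hvan _ _ (hG i i.2) (hsG1 i i.2))]
    simp_rw [h1]
    rw [prod_sum_ite_dvd_mul_sum_ite_dvd, Finset.mul_sum]
    refine Finset.sum_congr rfl fun d _ => ?_
    rw [Finset.mul_sum]
    refine Finset.sum_congr rfl fun d' _ => ?_
    have hiff : (∀ i : ↥H', Nat.lcm (d i) (d' i) ∣ m i) ↔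
        ∀ i : ↥H', ((Nat.lcm (d i) (d' i) : ℕ) : ℤ) ∣ (n : ℤ) + (i : ℤ) :=
      forall_congr' fun i => by rw [← hmcast i, Int.natCast_dvd_natCast]
    simp only [hiff, hccdef]
    split_ifs <;> simp
  -- Step 2: interchange of summations
  have hstep2 : ∑ n ∈ R, GPY.theta (((n : ℤ) + h₀).toNat) *
        ∏ h ∈ H', (divisorSumWeight (F h) x ((n : ℤ) + h).toNat *
          divisorSumWeight (G h) x ((n : ℤ) + h).toNat) =
      ∑ d ∈ lcmBox (↥H') D, ∑ d' ∈ lcmBox (↥H') D, cc d d' * Nθ d d' := by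
    rw [Finset.sum_congr rfl hstep1, Finset.sum_comm]
    refine Finset.sum_congr rfl fun d _ => ?_
    rw [Finset.sum_comm]
    refine Finset.sum_congr rfl fun d' _ => ?_
    simp only [hNθdef]
    rw [← Finset.sum_filter, Finset.mul_sum]
    exact Finset.sum_congr rfl fun n _ => mul_comm _ _
  clear_value a a' cc Nθ
  -- Step 3: arithmetic of the shifts and admissibility
  have hb' : ∀ i : ↥H', Int.gcd (b x + (i : ℤ)) (polymathW x) = 1 := fun i => hb x i (hmemH i).1
  have hbh₀ : Int.gcd (b x + h₀) (polymathW x) = 1 := hb x h₀ hh₀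
  have hxw' : 2 * P₀ ≤ ⌊polymathw x⌋₊ := hxw
  have hprime : ∀ p : ℕ, p.Prime → ∀ i j : ↥H', i ≠ j → (p : ℤ) ∣ (i : ℤ) - (j : ℤ) → p ∣ (polymathW x) := by
    intro p hp i j hij hdvd
    have hne : (i : ℤ) - (j : ℤ) ≠ 0 := sub_ne_zero.2 fun h => hij (Subtype.ext h)
    have h1 : p ∣ ((i : ℤ) - (j : ℤ)).natAbs := Int.natCast_dvd.1 hdvd
    have h2 : p ≤ ((i : ℤ) - (j : ℤ)).natAbs := Nat.le_of_dvd (Int.natAbs_pos.2 hne) h1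
    have h3 : ((i : ℤ) - (j : ℤ)).natAbs ≤ (i : ℤ).natAbs + (j : ℤ).natAbs := Int.natAbs_sub_le _ _
    have h4 : p ≤ ⌊polymathw x⌋₊ := by
      have := hP₀ i (hmemH i).1; have := hP₀ j (hmemH j).1; omega
    exact (hp.dvd_primorial_iff.2 h4 : p ∣ primorial ⌊polymathw x⌋₊)
  -- no prime of an admissible `[d_i,d'_i]` divides `h₀ - h_i`
  have hshift : ∀ d d' : ↥H' → ℕ, LcmCoprime (polymathW x) d d' → ∀ i : ↥H', ∀ p : ℕ, p.Prime →
      p ∣ Nat.lcm (d i) (d' i) → ¬ (p : ℤ) ∣ h₀ - (i : ℤ) := by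
    intro d d' hadm i p hp hpi hdvd
    have hpW : ¬ p ∣ (polymathW x) := fun h => by
      have := Nat.Coprime.coprime_dvd_left hpi (hadm.2 i)
      exact hp.one_lt.ne' (Nat.Coprime.eq_one_of_dvd this h)
    have hplt : ⌊polymathw x⌋₊ + 1 ≤ p := floor_polymathw_lt_of_not_dvd hp hpW
    have hne : h₀ - (i : ℤ) ≠ 0 := sub_ne_zero.2 (hmemH i).2.symm
    have h1 : p ∣ (h₀ - (i : ℤ)).natAbs := Int.natCast_dvd.1 hdvd
    have h2 : p ≤ (h₀ - (i : ℤ)).natAbs := Nat.le_of_dvd (Int.natAbs_pos.2 hne) h1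
    have h3 : (h₀ - (i : ℤ)).natAbs ≤ h₀.natAbs + (i : ℤ).natAbs := Int.natAbs_sub_le _ _
    have := hP₀ i (hmemH i).1
    omega
  have hNzero : ∀ d d' : ↥H' → ℕ, ¬ LcmCoprime (polymathW x) d d' → Nθ d d' = 0 := by
    intro d d' hnot
    rw [hNθdef]
    refine Finset.sum_eq_zero fun n hn => ?_
    exfalso
    obtain ⟨hnR, hdvd⟩ := Finset.mem_filter.1 hn
    exact not_forall_lcm_dvd_of_not_lcmCoprime hnot (fun i : ↥H' => (i : ℤ)) (b x) hb' hprime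
      (hRmem n hnR).2 hdvd
  -- Step 4: the admissible counts through one progression
  have hNadm : ∀ d ∈ lcmBox (↥H') D, ∀ d' ∈ lcmBox (↥H') D, LcmCoprime (polymathW x) d d' →
      |Nθ d d' - Θ / Nat.totient (modulusOf (polymathW x) (d, d'))| ≤
        4 * Real.log X₂ * primeCountingAPErrMax X₂ (modulusOf (polymathW x) (d, d')) := by
    intro d hd d' hd' hadm
    have hpos : ∀ i : ↥H', 0 < d i ∧ 0 < d' i := fun i => ⟨pos_of_mem_lcmBox hd i, pos_of_mem_lcmBox hd' i⟩
    have hqpos : 0 < modulusOf (polymathW x) (d, d') :=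
      Nat.mul_pos hWpos (Finset.prod_pos fun i _ => Nat.lcm_pos (hpos i).1 (hpos i).2)
    obtain ⟨a₀, ha₀⟩ := exists_crt_modulusOf (W := polymathW x) (b x) (fun i : ↥H' => (i : ℤ)) (t := (d, d')) hadm
    have hN₁ : 1 ≤ ((⌈x⌉₊ : ℕ) : ℤ) + h₀ := by
      have := hX₁z; have := hX₁1; omega
    have hsum := sum_theta_eq_thetaAP (ι := ↥H') hWpos (b := b x) (h := fun i : ↥H' => (i : ℤ))
      (h₀ := h₀) (t := (d, d')) hpos ha₀ (N₁ := ⌈x⌉₊) (N₂ := ⌊2 * x⌋₊) hN₁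
    have hcop := coprime_residue_modulusOf (ι := ↥H') (t := (d, d')) hqpos ha₀ hbh₀ (hshift d d' hadm)
    have hNθeq : Nθ d d' = thetaAP (modulusOf (polymathW x) (d, d'))
        (((a₀ + h₀) % (modulusOf (polymathW x) (d, d') : ℤ)).toNat) X₁ X₂ := by
      simp only [hNθdef, hRdef, polymathRange, hX₁def, hX₂def, thetaX1, thetaX2]
      exact hsum
    rw [hNθeq, hΘdef]
    exact abs_thetaAP_sub_le hqpos hcop hX₁₂
  -- Step 5: the coefficients: size and support
  have habs_a : ∀ i : ↥H', ∀ e : ℕ, 1 ≤ e → |a i e| ≤ M ∧ |a' i e| ≤ M := by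
    intro i e he
    have hlog0 : 0 ≤ Real.log e / Real.log x := div_nonneg (Real.log_natCast_nonneg e) hlog.le
    have hμ : |(μ e : ℝ)| ≤ 1 := by exact_mod_cast ArithmeticFunction.abs_moebius_le_one
    constructor
    · rw [hadef]; simp only; rw [abs_mul]
      rcases le_or_gt (Real.log e / Real.log x) 1 with hle | hgt
      · exact le_trans (mul_le_mul hμ (hMF i i.2 _ ⟨hlog0, hle⟩) (abs_nonneg _) zero_le_one) (by rw [one_mul])
      · rw [(hF i i.2).eq_zero _ (lt_of_lt_of_le (hsF1 i i.2) hgt.le), abs_zero, mul_zero]; exact hM0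
    · rw [ha'def]; simp only; rw [abs_mul]
      rcases le_or_gt (Real.log e / Real.log x) 1 with hle | hgt
      · exact le_trans (mul_le_mul hμ (hMG i i.2 _ ⟨hlog0, hle⟩) (abs_nonneg _) zero_le_one) (by rw [one_mul])
      · rw [(hG i i.2).eq_zero _ (lt_of_lt_of_le (hsG1 i i.2) hgt.le), abs_zero, mul_zero]; exact hM0
  have hcc_abs : ∀ d ∈ lcmBox (↥H') D, ∀ d' ∈ lcmBox (↥H') D, |cc d d'| ≤ M ^ k * M ^ k := by
    intro d hd d' hd'
    rw [hccdef]; simp only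
    rw [Finset.abs_prod]
    calc ∏ i, |a i (d i) * a' i (d' i)| ≤ ∏ _i : ↥H', (M * M) := by
          refine Finset.prod_le_prod (fun i _ => abs_nonneg _) fun i _ => ?_
          rw [abs_mul]
          exact mul_le_mul (habs_a i _ (pos_of_mem_lcmBox hd i)).1 (habs_a i _ (pos_of_mem_lcmBox hd' i)).2
            (abs_nonneg _) hM0
      _ = M ^ k * M ^ k := by
          rw [Finset.prod_const, Finset.card_univ, Fintype.card_coe, ← hkdef, mul_pow]
  -- support: `cc ≠ 0` forces squarefree entries with `d_i ≤ x^{sF i}`, `d'_i ≤ x^{sG i}`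
  have hsupp_a : ∀ i : ↥H', ∀ e : ℕ, 1 ≤ e → a i e ≠ 0 → Squarefree e ∧ (e : ℝ) ≤ x ^ sF i := by
    intro i e he hne
    rw [hadef] at hne; simp only at hne
    have hμ : (μ e : ℝ) ≠ 0 := left_ne_zero_of_mul hne
    have hFne : F i (Real.log e / Real.log x) ≠ 0 := right_ne_zero_of_mul hne
    refine ⟨ArithmeticFunction.moebius_ne_zero_iff_squarefree.1 (by exact_mod_cast hμ), ?_⟩
    by_contra hgt
    push Not at hgt
    apply hFne
    apply (hF i i.2).eq_zero
    rw [lt_div_iff₀ hlog, ← Real.log_rpow hxpos]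
    exact Real.log_lt_log (Real.rpow_pos_of_pos hxpos _) hgt
  have hsupp_a' : ∀ i : ↥H', ∀ e : ℕ, 1 ≤ e → a' i e ≠ 0 → Squarefree e ∧ (e : ℝ) ≤ x ^ sG i := by
    intro i e he hne
    rw [ha'def] at hne; simp only at hne
    have hμ : (μ e : ℝ) ≠ 0 := left_ne_zero_of_mul hne
    have hGne : G i (Real.log e / Real.log x) ≠ 0 := right_ne_zero_of_mul hne
    refine ⟨ArithmeticFunction.moebius_ne_zero_iff_squarefree.1 (by exact_mod_cast hμ), ?_⟩
    by_contra hgt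
    push Not at hgt
    apply hGne
    apply (hG i i.2).eq_zero
    rw [lt_div_iff₀ hlog, ← Real.log_rpow hxpos]
    exact Real.log_lt_log (Real.rpow_pos_of_pos hxpos _) hgt
  -- the set of pairs carrying the error
  set S : Finset ((↥H' → ℕ) × (↥H' → ℕ)) := (lcmBox (↥H') D ×ˢ lcmBox (↥H') D).filter fun t =>
    LcmCoprime (polymathW x) t.1 t.2 ∧ (∀ i, Squarefree (t.1 i) ∧ Squarefree (t.2 i)) ∧
      ∀ i, ((t.1 i : ℕ) : ℝ) ≤ x ^ sF i ∧ ((t.2 i : ℕ) : ℝ) ≤ x ^ sG i with hSdef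
  have hSprop : ∀ t ∈ S, LcmCoprime (polymathW x) t.1 t.2 ∧ ∀ i, Squarefree (t.1 i) ∧ Squarefree (t.2 i) :=
    fun t ht => ⟨(Finset.mem_filter.1 ht).2.1, (Finset.mem_filter.1 ht).2.2.1⟩
  set Q : ℕ := ⌊((polymathW x : ℕ) : ℝ) * x ^ σ⌋₊ with hQdef
  have hSQ : ∀ t ∈ S, modulusOf (polymathW x) t ∈ Finset.Icc 1 Q := by
    intro t ht
    obtain ⟨htbox, hadm, hsq, hsize⟩ := Finset.mem_filter.1 ht
    rw [Finset.mem_product] at htbox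
    have hpos : ∀ i : ↥H', 0 < t.1 i ∧ 0 < t.2 i :=
      fun i => ⟨pos_of_mem_lcmBox htbox.1 i, pos_of_mem_lcmBox htbox.2 i⟩
    have hqpos : 0 < modulusOf (polymathW x) t :=
      Nat.mul_pos hWpos (Finset.prod_pos fun i _ => Nat.lcm_pos (hpos i).1 (hpos i).2)
    refine Finset.mem_Icc.2 ⟨hqpos, Nat.le_floor ?_⟩
    rw [modulusOf, Nat.cast_mul, Nat.cast_prod]
    refine mul_le_mul_of_nonneg_left ?_ hWr.le
    have hterm : ∀ i : ↥H', ((Nat.lcm (t.1 i) (t.2 i) : ℕ) : ℝ) ≤ x ^ sF i * x ^ sG i := by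
      intro i
      have hlcm : Nat.lcm (t.1 i) (t.2 i) ≤ t.1 i * t.2 i :=
        Nat.le_of_dvd (Nat.mul_pos (hpos i).1 (hpos i).2) (Nat.lcm_dvd_mul _ _)
      calc ((Nat.lcm (t.1 i) (t.2 i) : ℕ) : ℝ) ≤ ((t.1 i * t.2 i : ℕ) : ℝ) := by exact_mod_cast hlcm
        _ = (t.1 i : ℝ) * (t.2 i : ℝ) := by push_cast; ring
        _ ≤ x ^ sF i * x ^ sG i :=
            mul_le_mul (hsize i).1 (hsize i).2 (Nat.cast_nonneg _) (Real.rpow_nonneg hx0 _)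
    calc ∏ i : ↥H', ((Nat.lcm (t.1 i) (t.2 i) : ℕ) : ℝ) ≤ ∏ i : ↥H', (x ^ sF i * x ^ sG i) :=
          Finset.prod_le_prod (fun i _ => Nat.cast_nonneg _) fun i _ => hterm i
      _ = x ^ σ := by
          rw [hσdef, Real.rpow_sum_of_pos hxpos, ← Finset.prod_coe_sort H']
          exact Finset.prod_congr rfl fun i _ => (Real.rpow_add hxpos _ _).symm
  -- Step 6: the error term
  have herr : |∑ d ∈ lcmBox (↥H') D, ∑ d' ∈ lcmBox (↥H') D, cc d d' * Nθ d d' -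
      Θ / Nat.totient (polymathW x) * Sφ x| ≤
      4 * (M ^ k * M ^ k) * Real.log X₂ *
        ∑ q ∈ Finset.Icc 1 Q, K ^ ω q * primeCountingAPErrMax X₂ q := by
    -- the main part of each admissible term
    have hmain : Θ / Nat.totient (polymathW x) * Sφ x = ∑ d ∈ lcmBox (↥H') D, ∑ d' ∈ lcmBox (↥H') D,
        if LcmCoprime (polymathW x) d d' then cc d d' * (Θ / Nat.totient (modulusOf (polymathW x) (d, d'))) else 0 := by
      rw [hSφdef]; simp only
      rw [Finset.mul_sum]
      refine Finset.sum_congr rfl fun d _ => ?_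
      rw [Finset.mul_sum]
      refine Finset.sum_congr rfl fun d' _ => ?_
      split_ifs with hadm
      · rw [totient_modulusOf (t := (d, d')) hadm, Nat.cast_mul, Nat.cast_prod, hccdef, hadef, ha'def]
        simp only
        rw [Finset.prod_inv_distrib]
        field_simp
      · rw [mul_zero]
    rw [hmain, ← Finset.sum_sub_distrib]
    simp_rw [← Finset.sum_sub_distrib]
    -- termwise bound
    have hterm : ∀ d ∈ lcmBox (↥H') D, ∀ d' ∈ lcmBox (↥H') D,
        |cc d d' * Nθ d d' - (if LcmCoprime (polymathW x) d d' then cc d d' * (Θ / Nat.totient (modulusOf (polymathW x) (d, d'))) else 0)| ≤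
          (M ^ k * M ^ k) * (if (d, d') ∈ S then
            4 * Real.log X₂ * primeCountingAPErrMax X₂ (modulusOf (polymathW x) (d, d')) else 0) := by
      intro d hd d' hd'
      by_cases hadm : LcmCoprime (polymathW x) d d'
      · rw [if_pos hadm, ← mul_sub, abs_mul]
        by_cases hS : (d, d') ∈ S
        · rw [if_pos hS]
          exact mul_le_mul (hcc_abs d hd d' hd') (hNadm d hd d' hd' hadm) (abs_nonneg _) (by positivity)
        · -- then `cc d d' = 0`
          have hcc0 : cc d d' = 0 := by
            by_contra hne
            apply hS
            rw [hSdef, Finset.mem_filter, Finset.mem_product]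
            have hfac : ∀ i : ↥H', a i (d i) ≠ 0 ∧ a' i (d' i) ≠ 0 := by
              intro i
              rw [hccdef] at hne; simp only at hne
              have := Finset.prod_ne_zero_iff.1 hne i (Finset.mem_univ i)
              exact ⟨left_ne_zero_of_mul this, right_ne_zero_of_mul this⟩
            refine ⟨⟨hd, hd'⟩, hadm, fun i => ?_, fun i => ?_⟩
            · exact ⟨(hsupp_a i _ (pos_of_mem_lcmBox hd i) (hfac i).1).1,
                (hsupp_a' i _ (pos_of_mem_lcmBox hd' i) (hfac i).2).1⟩
            · exact ⟨(hsupp_a i _ (pos_of_mem_lcmBox hd i) (hfac i).1).2,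
                (hsupp_a' i _ (pos_of_mem_lcmBox hd' i) (hfac i).2).2⟩
          rw [hcc0, abs_zero, zero_mul, if_neg hS, mul_zero]
      · rw [if_neg hadm, hNzero d d' hadm, mul_zero, sub_zero, abs_zero]
        refine mul_nonneg (mul_nonneg (pow_nonneg hM0 k) (pow_nonneg hM0 k)) ?_
        split_ifs
        · exact mul_nonneg (mul_nonneg (by norm_num) (Real.log_natCast_nonneg _))
            (primeCountingAPErrMax_nonneg _ _)
        · exact le_rfl
    calc |∑ d ∈ lcmBox (↥H') D, ∑ d' ∈ lcmBox (↥H') D, (cc d d' * Nθ d d' -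
            if LcmCoprime (polymathW x) d d' then cc d d' * (Θ / Nat.totient (modulusOf (polymathW x) (d, d'))) else 0)|
        ≤ ∑ d ∈ lcmBox (↥H') D, ∑ d' ∈ lcmBox (↥H') D, |cc d d' * Nθ d d' -
            (if LcmCoprime (polymathW x) d d' then cc d d' * (Θ / Nat.totient (modulusOf (polymathW x) (d, d'))) else 0)| := by
          refine (Finset.abs_sum_le_sum_abs _ _).trans (Finset.sum_le_sum fun d _ => ?_)
          exact Finset.abs_sum_le_sum_abs _ _
      _ ≤ ∑ d ∈ lcmBox (↥H') D, ∑ d' ∈ lcmBox (↥H') D, (M ^ k * M ^ k) * (if (d, d') ∈ S then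
            4 * Real.log X₂ * primeCountingAPErrMax X₂ (modulusOf (polymathW x) (d, d')) else 0) :=
          Finset.sum_le_sum fun d hd => Finset.sum_le_sum fun d' hd' => hterm d hd d' hd'
      _ = (M ^ k * M ^ k) * (4 * Real.log X₂ *
            ∑ t ∈ S, primeCountingAPErrMax X₂ (modulusOf (polymathW x) t)) := by
          rw [← Finset.sum_product' (f := fun d d' => (M ^ k * M ^ k) * (if (d, d') ∈ S then
            4 * Real.log X₂ * primeCountingAPErrMax X₂ (modulusOf (polymathW x) (d, d')) else 0))]
          simp only [Prod.mk.eta]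
          have hSsub : S ⊆ lcmBox (↥H') D ×ˢ lcmBox (↥H') D := Finset.filter_subset _ _
          simp_rw [mul_ite, mul_zero]
          rw [Finset.sum_ite_mem, Finset.inter_eq_right.2 hSsub]
          simp only [Finset.mul_sum]
      _ ≤ (M ^ k * M ^ k) * (4 * Real.log X₂ *
            ∑ q ∈ Finset.Icc 1 Q, K ^ ω q * primeCountingAPErrMax X₂ q) := by
          have hlogX₂ : 0 ≤ Real.log X₂ := Real.log_nonneg (by exact_mod_cast hX₁1.trans hX₁₂)
          refine mul_le_mul_of_nonneg_left (mul_le_mul_of_nonneg_left ?_ (by positivity)) (by positivity)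
          have := sum_modulusOf_le hWpos S hSprop hSQ (g := fun q => primeCountingAPErrMax X₂ q)
            (fun q => primeCountingAPErrMax_nonneg _ _)
          rw [Fintype.card_coe, ← hkdef] at this
          rw [hKdef]
          exact this
      _ = _ := by ring
  -- Step 7: the level of distribution bound at `X₂`
  have hlevel_bound : 4 * (M ^ k * M ^ k) * Real.log X₂ *
      ∑ q ∈ Finset.Icc 1 Q, K ^ ω q * primeCountingAPErrMax X₂ q ≤ ε / 3 * Mx := by
    -- `Q ≤ X₂^{θ - ε₁}`
    have hxX₂ : x ≤ (X₂ : ℝ) := by linarith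
    have hX₂3x : (X₂ : ℝ) ≤ 3 * x := by linarith
    have hX₂pos : (0 : ℝ) < X₂ := by linarith
    have hlog2 : Real.log x ^ (2 : ℝ) ≤ x ^ ε₁ := by
      have := hxlogε
      rwa [Real.norm_of_nonneg (Real.rpow_nonneg hlog.le _), Real.norm_of_nonneg (Real.rpow_nonneg hx0 _),
        one_mul] at this
    have hQle : Q ≤ ⌊(X₂ : ℝ) ^ (θ - ε₁)⌋₊ := by
      refine Nat.floor_le_floor ?_
      calc ((polymathW x : ℕ) : ℝ) * x ^ σ ≤ Real.log x ^ (2 : ℝ) * x ^ σ := by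
            refine mul_le_mul_of_nonneg_right ?_ (Real.rpow_nonneg hx0 _)
            rw [Real.rpow_two]; exact hxW
        _ ≤ x ^ ε₁ * x ^ σ := mul_le_mul_of_nonneg_right hlog2 (Real.rpow_nonneg hx0 _)
        _ = x ^ (θ - ε₁ - ε₁) := by
            rw [← Real.rpow_add hxpos]; congr 1; rw [hε₁def]; ring
        _ ≤ x ^ (θ - ε₁) := Real.rpow_le_rpow_of_exponent_le hx1.le (by linarith only [hε₁])
        _ ≤ (X₂ : ℝ) ^ (θ - ε₁) := Real.rpow_le_rpow hx0 hxX₂ (by linarith only [hε₁def, hσ0, hθ0, hσθ])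
    have hsum_le : ∑ q ∈ Finset.Icc 1 Q, K ^ ω q * primeCountingAPErrMax X₂ q ≤ Lsum := by
      rw [hLsum_def]
      exact Finset.sum_le_sum_of_subset_of_nonneg (Finset.Icc_subset_Icc_right hQle)
        fun q _ _ => mul_nonneg (pow_nonneg hK0 _) (primeCountingAPErrMax_nonneg _ _)
    -- the hypothesis at `X₂`
    have hCbx : Lsum ≤ Cb * ((X₂ : ℝ) / Real.log X₂ ^ ((k : ℝ) + 4)) := by
      have h := hLsum
      have hnn : 0 ≤ Lsum := by
        rw [hLsum_def]
        exact Finset.sum_nonneg fun q _ => mul_nonneg (pow_nonneg hK0 _)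
          (primeCountingAPErrMax_nonneg _ _)
      have hlogX₂ : 0 < Real.log X₂ := Real.log_pos (by linarith)
      rwa [Real.norm_of_nonneg hnn, Real.norm_of_nonneg (div_nonneg hX₂pos.le (Real.rpow_nonneg hlogX₂.le _))] at h
    -- sizes
    have hlogX₂x : Real.log x ≤ Real.log X₂ := Real.log_le_log (by linarith) hxX₂
    have hlogX₂2 : Real.log X₂ ≤ 2 * Real.log x := by
      have hsq : (3 : ℝ) * x ≤ x ^ 2 := by rw [sq]; exact mul_le_mul_of_nonneg_right hx3.le hx0
      calc Real.log X₂ ≤ Real.log (x ^ 2) := Real.log_le_log hX₂pos (hX₂3x.trans hsq)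
        _ = 2 * Real.log x := by rw [Real.log_pow, Nat.cast_ofNat]
    have hfrac : (X₂ : ℝ) / Real.log X₂ ^ ((k : ℝ) + 4) ≤ 3 * x / Real.log x ^ ((k : ℝ) + 4) := by
      have h1 : Real.log x ^ ((k : ℝ) + 4) ≤ Real.log X₂ ^ ((k : ℝ) + 4) :=
        Real.rpow_le_rpow hlog.le hlogX₂x (by positivity)
      have h2 : 0 < Real.log x ^ ((k : ℝ) + 4) := Real.rpow_pos_of_pos hlog _
      calc (X₂ : ℝ) / Real.log X₂ ^ ((k : ℝ) + 4) ≤ (X₂ : ℝ) / Real.log x ^ ((k : ℝ) + 4) :=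
            div_le_div_of_nonneg_left hX₂pos.le h2 h1
        _ ≤ 3 * x / Real.log x ^ ((k : ℝ) + 4) := by gcongr
    have hden : polymathB x ^ k * Nat.totient (polymathW x) ≤ Real.log x ^ (k + 2) := by
      have hφW : (Nat.totient (polymathW x) : ℝ) ≤ (polymathW x) := by exact_mod_cast Nat.totient_le (polymathW x)
      calc polymathB x ^ k * Nat.totient (polymathW x) ≤ Real.log x ^ k * Real.log x ^ 2 :=
            mul_le_mul (pow_le_pow_left₀ hB.le (polymathB_le_log hx1.le) k) (hφW.trans hxW) hφr.le
              (pow_nonneg hlog.le k)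
        _ = Real.log x ^ (k + 2) := by ring
    have hrpow : Real.log x ^ ((k : ℝ) + 4) = Real.log x ^ (k + 2) * Real.log x ^ 2 := by
      rw [show (k : ℝ) + 4 = ((k + 4 : ℕ) : ℝ) by push_cast; ring, Real.rpow_natCast]; ring
    -- assemble
    have hlog0 : Real.log x ≠ 0 := hlog.ne'
    have hCerr' : Cerr ≤ ε * Real.log x := by
      have h := hxCerr
      rw [div_le_iff₀ hε] at h
      linarith
    calc 4 * (M ^ k * M ^ k) * Real.log X₂ * ∑ q ∈ Finset.Icc 1 Q, K ^ ω q * primeCountingAPErrMax X₂ q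
        ≤ 4 * (M ^ k * M ^ k) * (2 * Real.log x) * (Cb * (3 * x / Real.log x ^ ((k : ℝ) + 4))) := by
          refine mul_le_mul (mul_le_mul_of_nonneg_left hlogX₂2 (by positivity))
            (hsum_le.trans (hCbx.trans (mul_le_mul_of_nonneg_left hfrac hCbpos.le))) ?_ (by positivity)
          exact Finset.sum_nonneg fun q _ => mul_nonneg (pow_nonneg hK0 _)
            (primeCountingAPErrMax_nonneg _ _)
      _ = Cerr * x / (3 * (Real.log x ^ (k + 2) * Real.log x)) := by
          rw [hrpow, hCerrdef]; field_simp; ring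
      _ ≤ ε * Real.log x * x / (3 * (Real.log x ^ (k + 2) * Real.log x)) := by
          gcongr
      _ = ε / 3 * (x / Real.log x ^ (k + 2)) := by field_simp
      _ ≤ ε / 3 * Mx := by
          rw [hMx]
          refine mul_le_mul_of_nonneg_left (div_le_div_of_nonneg_left hx0 (by positivity) hden) (by positivity)
  -- Step 8: Lemma 4.1 and the prime number theorem at this `x`
  have h41x : |Sφ x - c * (polymathB x ^ k)⁻¹| ≤ ε / 9 * (polymathB x ^ k)⁻¹ := by
    have h := hx41
    rw [dist_eq_norm, Real.norm_eq_abs] at h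
    have e : Sφ x - c * (polymathB x ^ k)⁻¹ = (polymathB x ^ k)⁻¹ * (polymathB x ^ k * Sφ x - c) := by
      field_simp
    rw [e, abs_mul, abs_of_pos (inv_pos.2 hBk), mul_comm]
    exact mul_le_mul_of_nonneg_right h.le (inv_pos.2 hBk).le
  -- conclusion
  rw [Real.norm_eq_abs, Real.norm_eq_abs, abs_of_pos hMx0, hstep2]
  have hsplit : ∑ d ∈ lcmBox (↥H') D, ∑ d' ∈ lcmBox (↥H') D, cc d d' * Nθ d d' - c * Mx =
      (∑ d ∈ lcmBox (↥H') D, ∑ d' ∈ lcmBox (↥H') D, cc d d' * Nθ d d' - Θ / Nat.totient (polymathW x) * Sφ x) +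
      Θ / Nat.totient (polymathW x) * (Sφ x - c * (polymathB x ^ k)⁻¹) +
      c * (polymathB x ^ k)⁻¹ / Nat.totient (polymathW x) * (Θ - x) := by
    rw [hMx]; field_simp; ring
  rw [hsplit]
  have hT2 : |Θ / Nat.totient (polymathW x) * (Sφ x - c * (polymathB x ^ k)⁻¹)| ≤ ε / 3 * Mx := by
    rw [abs_mul, abs_of_nonneg (div_nonneg hΘ0 hφr.le)]
    calc Θ / Nat.totient (polymathW x) * |Sφ x - c * (polymathB x ^ k)⁻¹|
        ≤ (2 * x) / Nat.totient (polymathW x) * (ε / 9 * (polymathB x ^ k)⁻¹) :=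
          mul_le_mul (div_le_div_of_nonneg_right hΘ2x hφr.le) h41x (abs_nonneg _) (by positivity)
      _ = 2 * ε / 9 * Mx := by rw [hMx]; field_simp
      _ ≤ ε / 3 * Mx := mul_le_mul_of_nonneg_right (by linarith only [hε]) hMx0.le
  have hT3 : |c * (polymathB x ^ k)⁻¹ / Nat.totient (polymathW x) * (Θ - x)| ≤ ε / 3 * Mx := by
    rw [abs_mul, abs_div, abs_mul, abs_of_pos (inv_pos.2 hBk), abs_of_pos hφr]
    calc |c| * (polymathB x ^ k)⁻¹ / Nat.totient (polymathW x) * |Θ - x|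
        ≤ |c| * (polymathB x ^ k)⁻¹ / Nat.totient (polymathW x) * (εP * x) :=
          mul_le_mul_of_nonneg_left hΘx (by positivity)
      _ = |c| * εP * Mx := by rw [hMx]; field_simp
      _ ≤ ε / 3 * Mx := mul_le_mul_of_nonneg_right hεPc hMx0.le
  calc _ ≤ |∑ d ∈ lcmBox (↥H') D, ∑ d' ∈ lcmBox (↥H') D, cc d d' * Nθ d d' - Θ / Nat.totient (polymathW x) * Sφ x| +
        |Θ / Nat.totient (polymathW x) * (Sφ x - c * (polymathB x ^ k)⁻¹)| +
        |c * (polymathB x ^ k)⁻¹ / Nat.totient (polymathW x) * (Θ - x)| :=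
        (abs_add_le _ _).trans (add_le_add (abs_add_le _ _) le_rfl)
    _ ≤ ε / 3 * Mx + ε / 3 * Mx + ε / 3 * Mx :=
        add_le_add (add_le_add (herr.trans hlevel_bound) hT2) hT3
    _ = ε * Mx := by ring

/-- **Polymath 8b, Theorem 3.12(i), PROVED** (`DHL[k, m+1]` from `EH[θ]` and `M_{k,ε} > 2m/θ`; the named
fact `weakDHL_of_polymathFunctional_gt` of `PolymathBoundedGaps.lean`): its three ingredients are now
theorems — Theorem 3.5(i) (`theta_divisorSumWeights_asymptotic_holds`), Theorem 3.6(i)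
(`divisorSumWeights_asymptotic_holds`) and the analytic approximation step of §5.3
(`exists_tensorCutoffs_of_polymathFunctional_gt_holds`) — assembled by
`weakDHL_of_polymathFunctional_gt_of_parts`. [cite: Polymath8b2014, Theorem 3.12(i)] -/
theorem weakDHL_of_polymathFunctional_gt_holds : weakDHL_of_polymathFunctional_gt :=
  weakDHL_of_polymathFunctional_gt_of_parts theta_divisorSumWeights_asymptotic_holds
    divisorSumWeights_asymptotic_holds exists_tensorCutoffs_of_polymathFunctional_gt_holds

end Literature.NumberTheory.Sieve
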